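import Summits.AtomisticToContinuum.FouriersLaw.Theorems.BondHeatUncertaintySubdiffusiveBondHeatIffBoundedResponse
import Summits.AtomisticToContinuum.FouriersLaw.Theorems.BondHeatUncertaintySubdiffusiveBondHeatOhmicFloor
import Summits.AtomisticToContinuum.FouriersLaw.Theorems.BoundaryEscapeDeficitEscapeLawOfCruxes
import Literature.Barriers.AtomisticToContinuum.FixedLengthNoConductivityControl

/-!
# Crux `HalfChainTailLaw` (stmt-AtomisticToContinuum-12235) — PLACING THEOREMS (crux-strategist r1)

Route `BoundaryEscapeDeficit` (sub-problem `FouriersLaw`).  Notation = the route's `let`s, VERBATIM: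
`K_N(u) = ∫ (p₀² − T)·P_u(p₀² − T) dμ_T^N`, `θ_N(t) = (γ/T²)∫₀ᵗ K_N`, `E_N = 1 − (γ/T²)∫_{(0,∞)} K_N`.

This file is the kernel-checked half of the r1 STRATEGY-CENSUS.  It records, over tree vocabulary and with no `sorry`:

1. `fouriersLaw_iff_escapeLaw` — the route TARGET `EscapeLaw` (12234, `(N−1)γE_N → κ_b > 0`) **is** the sub-problem
   statement `FouriersLaw`, unconditionally (weak-NESS uniqueness `nessUnique_proof`, the response identity
   `responseIdentity_proof`, existence `pinnedChain_exists_isSteadyState`, `totalCurrent_zero`; uniqueness of `δ`-limits).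
2. `hasBoundedResponse_of_halfChainTailLaw_diffusiveCrossover` — the PAIR (crux 12235, crux 12236) meets the catalogued
   barrier `Literature.Barriers.AtomisticToContinuum.HasBoundedResponse` HEAD-ON (via the landed Ohmic floor
   `stub_ohmicFloor_of_tail_crossover` and `boundedResponse_of_ohmicFloor`).
3. THE ON-PATH THEOREM `halfChainTailLaw_of_fouriersLaw`:
   `EventualMonotone → SumRule → DiffusiveCrossover → FouriersLaw → HalfChainTailLaw` — modulo the route's OWN second crux
   (12236), its own cheapest-kill support item `SumRule` (12241, itself NECESSARY for the crux: `sumRule_of_halfChainTailLaw`)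
   and one regularity hypothesis (`EventualMonotone`: `t ↦ θ_M(t)` eventually non-decreasing, i.e. the boundary
   autocorrelation `K_M` eventually `≥ 0`, eventually in `M`), the crux is IMPLIED BY the sub-problem statement.  Mechanism:
   `FouriersLaw ⇒ E_N ≍ 1/N` (item 1), the crossover transports this to the CLOCK `t = a₀N², a₁N²` (`ClockTailLaw`), and
   monotonicity interpolates between clock times (`⌊√(t/a₁)⌋`, `⌈√(t/a₀)⌉`).  The sign of the crossover constant `C₂` is
   forced positive by `SumRule ∧ EventualMonotone` (`crossoverConst_pos`).
4. Hence `halfChainTailLaw_iff`: **`EventualMonotone → DiffusiveCrossover → EscapeNonOscillation →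
   (HalfChainTailLaw ↔ FouriersLaw ∧ SumRule)`** — given the rest of the route's own cone and the monotone regularity, the
   crux is EXACTLY Fourier's law plus the sum rule.  (`→` is the route's deciding theorem `closes` fed with the two proved
   items; `←` is item 3.)
5. The sharpest form, with no `EscapeNonOscillation`, no steady state and no `δ`-limit in it: `halfChainTailLaw_iff_ohmicBracket`:
   **`EventualMonotone → DiffusiveCrossover → (HalfChainTailLaw ↔ OhmicBracket ∧ SumRule)`**, where `OhmicBracket` is the
   `1/N`-bracket `c_E/N ≤ E_N ≤ C_E/N` of the escape deficit — bounded response (item 11071, `boundedResponse_of_ohmicBracket`)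
   plus the Ohmic floor (no insulation).  `closes` consumes the pair (12235, 12236) ONLY through this bracket
   (`ohmicBracket_of_halfChainTailLaw_diffusiveCrossover` → `escapeLaw_of_ohmicBracket_escapeNonOscillation` →
   `fouriersLaw_of_escapeLaw`), and `fouriersLaw_iff_ohmicBracket_escapeNonOscillation` records `S ↔ OhmicBracket ∧ 12238`.

Reading for the tribunal: the crux alone is not `≥ S` (it speaks of the half-line limit `M → ∞` only; the BC2 probe
`HalfChainTailLaw → FouriersLaw` fails), but every counterexample to it at a Fourier-true parameter point must break
`DiffusiveCrossover`, `SumRule` or `EventualMonotone`; and no proof of it can avoid proving bounded response jointly with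
12236.  Pure real/filter analysis over abstract sequences (`§ Abstract`), instantiated at the verbatim objects (`§ Placing`).
Nothing here closes an item.  Standard axioms.
-/

noncomputable section

open MeasureTheory Filter Topology Set
open Literature.MathematicalPhysics.KineticTheory.HeatConduction

namespace Summit.AtomisticToContinuum.FouriersLaw.Cruxes.HalfChainTailLaw.StrategistR1

open Summit.AtomisticToContinuum.FouriersLaw.Theses.BoundaryEscapeDeficit
  (HalfChainTailLaw DiffusiveCrossover EscapeNonOscillation EscapeLaw SumRule NessUnique ResponseIdentity
    NessUnique_holds closes)
open Summit.AtomisticToContinuum.FouriersLaw.Theorems.SubdiffusiveBondHeat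
  (boundedResponse_of_ohmicFloor stub_ohmicFloor_of_tail_crossover boundaryEscapeDeficit_responseIdentity_holds)

/-! ## Abstract real / filter analysis -/

section Abstract

variable (θ : ℕ → ℝ → ℝ) (E : ℕ → ℝ)

/-- A convergent `(N−1)γE_N → κ_b > 0` brackets `E_N` between `κ_b/(2γ)/N` and `(4κ_b/γ)/N` eventually. [folklore] -/
theorem eventually_escape_bounds {γ κb : ℝ} (hγ : 0 < γ) (hκ : 0 < κb)
    (hlim : Tendsto (fun N : ℕ => ((N : ℝ) - 1) * γ * E N) atTop (𝓝 κb)) :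
    ∀ᶠ N : ℕ in atTop, κb / (2 * γ) / (N : ℝ) ≤ E N ∧ E N ≤ 4 * κb / γ / (N : ℝ) := by
  have h1 : ∀ᶠ N : ℕ in atTop, κb / 2 < ((N : ℝ) - 1) * γ * E N :=
    hlim.eventually_const_lt (by linarith)
  have h2 : ∀ᶠ N : ℕ in atTop, ((N : ℝ) - 1) * γ * E N < 2 * κb :=
    hlim.eventually_lt_const (by linarith)
  have h3 : ∀ᶠ N : ℕ in atTop, (2 : ℝ) ≤ N := by
    filter_upwards [eventually_ge_atTop 2] with N hN
    exact_mod_cast hN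
  filter_upwards [h1, h2, h3] with N hlo hhi hN2
  have hNpos : (0 : ℝ) < N := by linarith
  have hN1 : (0 : ℝ) < (N : ℝ) - 1 := by linarith
  have hprod : 0 < (((N : ℝ) - 1) * γ) * E N := by
    have : 0 < ((N : ℝ) - 1) * γ * E N := by linarith
    simpa [mul_assoc] using this
  have hEpos : 0 < E N := (mul_pos_iff_of_pos_left (mul_pos hN1 hγ)).1 hprod
  have hγE : 0 < γ * E N := mul_pos hγ hEpos
  constructor
  · rw [div_le_iff₀ hNpos, div_le_iff₀ (by positivity)]
    nlinarith
  · rw [le_div_iff₀ hNpos, le_div_iff₀ hγ]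
    nlinarith

/-- Upper clock bound: `c₂(1 − θ_M(a₁N²)) ≤ E_N ≤ C_E/N` gives `1 − θ_M(a₁N²) ≤ (C_E/c₂)/N`. [folklore] -/
theorem clock_upper {a₀ a₁ c₂ C₂ cE CE : ℝ} (hc₂ : 0 < c₂)
    (hE : ∀ᶠ N : ℕ in atTop, cE / (N : ℝ) ≤ E N ∧ E N ≤ CE / (N : ℝ))
    (hcross : ∀ᶠ N : ℕ in atTop, ∀ᶠ M : ℕ in atTop,
      c₂ * (1 - θ M (a₁ * (N : ℝ) ^ 2)) ≤ E N ∧ E N ≤ C₂ * (1 - θ M (a₀ * (N : ℝ) ^ 2))) :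
    ∀ᶠ N : ℕ in atTop, ∀ᶠ M : ℕ in atTop, 1 - θ M (a₁ * (N : ℝ) ^ 2) ≤ CE / c₂ / (N : ℝ) := by
  filter_upwards [hE, hcross] with N hEN hXN
  filter_upwards [hXN] with M hM
  have h : c₂ * (1 - θ M (a₁ * (N : ℝ) ^ 2)) ≤ CE / (N : ℝ) := hM.1.trans hEN.2
  rw [div_right_comm, le_div_iff₀ hc₂]
  linarith

/-- Lower clock bound: `c_E/N ≤ E_N ≤ C₂(1 − θ_M(a₀N²))` with `C₂ > 0` gives `(c_E/C₂)/N ≤ 1 − θ_M(a₀N²)`. [folklore] -/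
theorem clock_lower {a₀ a₁ c₂ C₂ cE CE : ℝ} (hC₂ : 0 < C₂)
    (hE : ∀ᶠ N : ℕ in atTop, cE / (N : ℝ) ≤ E N ∧ E N ≤ CE / (N : ℝ))
    (hcross : ∀ᶠ N : ℕ in atTop, ∀ᶠ M : ℕ in atTop,
      c₂ * (1 - θ M (a₁ * (N : ℝ) ^ 2)) ≤ E N ∧ E N ≤ C₂ * (1 - θ M (a₀ * (N : ℝ) ^ 2))) :
    ∀ᶠ N : ℕ in atTop, ∀ᶠ M : ℕ in atTop, cE / C₂ / (N : ℝ) ≤ 1 - θ M (a₀ * (N : ℝ) ^ 2) := by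
  filter_upwards [hE, hcross] with N hEN hXN
  filter_upwards [hXN] with M hM
  have h : cE / (N : ℝ) ≤ C₂ * (1 - θ M (a₀ * (N : ℝ) ^ 2)) := hEN.1.trans hM.2
  rw [div_right_comm, div_le_iff₀ hC₂]
  linarith

/-- **The crossover constant is forced positive.**  If `E_N ≥ c_E/N > 0` eventually, the crossover upper bound
`E_N ≤ C₂(1 − θ_M(a₀N²))` holds eventually, `t ↦ θ_M(t)` is eventually non-decreasing (eventually in `M`) and the
sum rule `θ_M(t) → 1` (iterated limit) holds, then `0 < C₂`: otherwise `θ_M(a₀N²) ≥ 1 + δ` for one large `N` and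
all large `M`, monotonicity propagates the overshoot to all later times, contradicting the sum rule. [folklore] -/
theorem crossoverConst_pos {a₀ a₁ c₂ C₂ cE CE u₀ : ℝ} (ha₀ : 0 < a₀) (hcE : 0 < cE)
    (hmono : ∀ a b : ℝ, u₀ ≤ a → a ≤ b → ∀ᶠ M : ℕ in atTop, θ M a ≤ θ M b)
    (hsum : ∀ ε : ℝ, 0 < ε → ∃ t₀ : ℝ, ∀ t : ℝ, t₀ ≤ t → ∀ᶠ M : ℕ in atTop, |1 - θ M t| ≤ ε)
    (hE : ∀ᶠ N : ℕ in atTop, cE / (N : ℝ) ≤ E N ∧ E N ≤ CE / (N : ℝ))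
    (hcross : ∀ᶠ N : ℕ in atTop, ∀ᶠ M : ℕ in atTop,
      c₂ * (1 - θ M (a₁ * (N : ℝ) ^ 2)) ≤ E N ∧ E N ≤ C₂ * (1 - θ M (a₀ * (N : ℝ) ^ 2))) :
    0 < C₂ := by
  by_contra hC
  rw [not_lt] at hC
  have hNev : ∀ᶠ N : ℕ in atTop, u₀ ≤ a₀ * (N : ℝ) ^ 2 := by
    have : Tendsto (fun N : ℕ => a₀ * (N : ℝ) ^ 2) atTop atTop := by
      apply Tendsto.const_mul_atTop ha₀
      exact (tendsto_pow_atTop two_ne_zero).comp tendsto_natCast_atTop_atTop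
    exact this.eventually_ge_atTop u₀
  have hN1 : ∀ᶠ N : ℕ in atTop, (1 : ℝ) ≤ N := by
    filter_upwards [eventually_ge_atTop 1] with N hN
    exact_mod_cast hN
  obtain ⟨N, hEN, hXN, huN, hN⟩ := (hE.and (hcross.and (hNev.and hN1))).exists
  have hNpos : (0 : ℝ) < N := by linarith
  have hENpos : 0 < E N := lt_of_lt_of_le (div_pos hcE hNpos) hEN.1
  rcases hC.lt_or_eq with hneg | hzero
  · -- `C₂ < 0`: overshoot `θ_M(a₀N²) ≥ 1 + δ`, `δ = E_N/(-C₂) > 0`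
    set δ : ℝ := E N / (-C₂) with hδ
    have hδpos : 0 < δ := div_pos hENpos (neg_pos.2 hneg)
    have hover : ∀ᶠ M : ℕ in atTop, 1 + δ ≤ θ M (a₀ * (N : ℝ) ^ 2) := by
      filter_upwards [hXN] with M hM
      have h2 : E N ≤ C₂ * (1 - θ M (a₀ * (N : ℝ) ^ 2)) := hM.2
      have h3 : E N / (-C₂) ≤ θ M (a₀ * (N : ℝ) ^ 2) - 1 := by
        rw [div_le_iff₀ (neg_pos.2 hneg)]
        linarith
      linarith
    obtain ⟨t₁, ht₁⟩ := hsum (δ / 2) (by linarith)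
    set t : ℝ := max t₁ (a₀ * (N : ℝ) ^ 2) with ht
    have hmt : ∀ᶠ M : ℕ in atTop, θ M (a₀ * (N : ℝ) ^ 2) ≤ θ M t :=
      hmono _ _ huN (le_max_right _ _)
    have hst : ∀ᶠ M : ℕ in atTop, |1 - θ M t| ≤ δ / 2 := ht₁ t (le_max_left _ _)
    obtain ⟨M, h1, h2, h3⟩ := (hover.and (hmt.and hst)).exists
    have h4 := (abs_le.1 h3).1
    linarith
  · -- `C₂ = 0`: `0 < E_N ≤ 0`
    obtain ⟨M, hM⟩ := hXN.exists
    have : E N ≤ 0 := by simpa [hzero] using hM.2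
    linarith

/-- **Clock law + eventual monotonicity ⟹ the two-sided tail law.**  From `c'/N ≤ 1 − θ_M(a₀N²)` and
`1 − θ_M(a₁N²) ≤ C'/N` (all large `N`, eventually in `M`) and `θ_M` eventually non-decreasing in `t`: for `t ≥ t₀`,
eventually in `M`, `(c'√a₀/2)/√t ≤ 1 − θ_M(t) ≤ (2·max C' 0·√a₁)/√t` — interpolate with `N = ⌊√(t/a₁)⌋` (upper) and
`N' = ⌈√(t/a₀)⌉` (lower). [folklore] -/
theorem tail_of_clock_monotone {a₀ a₁ c' C' u₀ : ℝ} (ha₀ : 0 < a₀) (ha₁ : 0 < a₁) (hc' : 0 < c')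
    (hu₀ : 0 < u₀)
    (hmono : ∀ a b : ℝ, u₀ ≤ a → a ≤ b → ∀ᶠ M : ℕ in atTop, θ M a ≤ θ M b)
    (hclock : ∀ᶠ N : ℕ in atTop, ∀ᶠ M : ℕ in atTop,
      c' / (N : ℝ) ≤ 1 - θ M (a₀ * (N : ℝ) ^ 2) ∧ 1 - θ M (a₁ * (N : ℝ) ^ 2) ≤ C' / (N : ℝ)) :
    ∃ c C t₀ : ℝ, 0 < c ∧ 0 < t₀ ∧ ∀ t : ℝ, t₀ ≤ t → ∀ᶠ M : ℕ in atTop,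
      c / Real.sqrt t ≤ 1 - θ M t ∧ 1 - θ M t ≤ C / Real.sqrt t := by
  obtain ⟨N₀, hN₀⟩ := eventually_atTop.1 hclock
  have hsa₀ : 0 < Real.sqrt a₀ := Real.sqrt_pos.2 ha₀
  have hsa₁ : 0 < Real.sqrt a₁ := Real.sqrt_pos.2 ha₁
  have hN₀sq : (0 : ℝ) ≤ (N₀ : ℝ) ^ 2 := by positivity
  refine ⟨c' * Real.sqrt a₀ / 2, 2 * max C' 0 * Real.sqrt a₁,
    4 * u₀ + 4 * a₁ + a₁ * (N₀ : ℝ) ^ 2 + a₀ + a₀ * (N₀ : ℝ) ^ 2, by positivity, by positivity, ?_⟩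
  intro t ht
  have h01 : 0 ≤ a₁ * (N₀ : ℝ) ^ 2 := by positivity
  have h00 : 0 ≤ a₀ * (N₀ : ℝ) ^ 2 := by positivity
  have ht0 : 0 < t := by linarith
  have htu : u₀ ≤ t := by linarith
  have ht4u : 4 * u₀ ≤ t := by linarith
  have ht4a₁ : 4 * a₁ ≤ t := by linarith
  have hta₁N : a₁ * (N₀ : ℝ) ^ 2 ≤ t := by linarith
  have hta₀ : a₀ ≤ t := by linarith
  have hta₀N : a₀ * (N₀ : ℝ) ^ 2 ≤ t := by linarith
  have hst : 0 < Real.sqrt t := Real.sqrt_pos.2 ht0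
  -- ### upper branch: N = ⌊√(t/a₁)⌋
  set x₁ : ℝ := Real.sqrt (t / a₁) with hx₁
  have hx₁nn : 0 ≤ x₁ := Real.sqrt_nonneg _
  have hx₁def : x₁ = Real.sqrt t / Real.sqrt a₁ := by rw [hx₁, Real.sqrt_div ht0.le]
  have hx₁sq : x₁ ^ 2 = t / a₁ := by rw [hx₁, Real.sq_sqrt (by positivity)]
  have hx₁2 : (2 : ℝ) ≤ x₁ := by
    calc (2 : ℝ) = Real.sqrt ((2 : ℝ) ^ 2) := (Real.sqrt_sq (by norm_num)).symm
      _ ≤ Real.sqrt (t / a₁) := Real.sqrt_le_sqrt (by rw [le_div_iff₀ ha₁]; linarith)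
  have hx₁N₀ : (N₀ : ℝ) ≤ x₁ := by
    calc (N₀ : ℝ) = Real.sqrt ((N₀ : ℝ) ^ 2) := (Real.sqrt_sq (by positivity)).symm
      _ ≤ Real.sqrt (t / a₁) := Real.sqrt_le_sqrt (by rw [le_div_iff₀ ha₁]; linarith)
  set N : ℕ := ⌊x₁⌋₊ with hNdef
  have hNx : (N : ℝ) ≤ x₁ := Nat.floor_le hx₁nn
  have hxN : x₁ < (N : ℝ) + 1 := Nat.lt_floor_add_one x₁
  have hN₀N : N₀ ≤ N := Nat.le_floor hx₁N₀
  have hNhalf : x₁ / 2 ≤ (N : ℝ) := by linarith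
  have hNpos : (0 : ℝ) < N := by linarith
  have hNsq : (N : ℝ) ^ 2 ≤ t / a₁ := by
    rw [← hx₁sq]; exact pow_le_pow_left₀ hNpos.le hNx 2
  have hleU : a₁ * (N : ℝ) ^ 2 ≤ t := by
    have := mul_le_mul_of_nonneg_left hNsq ha₁.le
    rwa [mul_div_cancel₀ _ ha₁.ne'] at this
  have huU : u₀ ≤ a₁ * (N : ℝ) ^ 2 := by
    have h1 : (x₁ / 2) ^ 2 ≤ (N : ℝ) ^ 2 := pow_le_pow_left₀ (by positivity) hNhalf 2
    have h2 : a₁ * (x₁ / 2) ^ 2 = t / 4 := by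
      rw [div_pow, hx₁sq]; field_simp; ring
    nlinarith
  have hmonoU : ∀ᶠ M : ℕ in atTop, θ M (a₁ * (N : ℝ) ^ 2) ≤ θ M t := hmono _ _ huU hleU
  have hclockU := hN₀ N hN₀N
  -- ### lower branch: N' = ⌈√(t/a₀)⌉
  set x₀ : ℝ := Real.sqrt (t / a₀) with hx₀
  have hx₀nn : 0 ≤ x₀ := Real.sqrt_nonneg _
  have hx₀def : x₀ = Real.sqrt t / Real.sqrt a₀ := by rw [hx₀, Real.sqrt_div ht0.le]
  have hx₀sq : x₀ ^ 2 = t / a₀ := by rw [hx₀, Real.sq_sqrt (by positivity)]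
  have hx₀1 : (1 : ℝ) ≤ x₀ := by
    calc (1 : ℝ) = Real.sqrt ((1 : ℝ) ^ 2) := (Real.sqrt_sq (by norm_num)).symm
      _ ≤ Real.sqrt (t / a₀) := Real.sqrt_le_sqrt (by rw [le_div_iff₀ ha₀]; linarith)
  have hx₀N₀ : (N₀ : ℝ) ≤ x₀ := by
    calc (N₀ : ℝ) = Real.sqrt ((N₀ : ℝ) ^ 2) := (Real.sqrt_sq (by positivity)).symm
      _ ≤ Real.sqrt (t / a₀) := Real.sqrt_le_sqrt (by rw [le_div_iff₀ ha₀]; linarith)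
  set N' : ℕ := ⌈x₀⌉₊ with hN'def
  have hN'x : x₀ ≤ (N' : ℝ) := Nat.le_ceil x₀
  have hN'lt : (N' : ℝ) < x₀ + 1 := Nat.ceil_lt_add_one hx₀nn
  have hN₀N' : N₀ ≤ N' := by exact_mod_cast hx₀N₀.trans hN'x
  have hN'pos : (0 : ℝ) < N' := by linarith
  have hN'le : (N' : ℝ) ≤ 2 * x₀ := by linarith
  have hleL : t ≤ a₀ * (N' : ℝ) ^ 2 := by
    have h1 : x₀ ^ 2 ≤ (N' : ℝ) ^ 2 := pow_le_pow_left₀ hx₀nn hN'x 2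
    rw [hx₀sq, div_le_iff₀ ha₀] at h1
    linarith
  have hmonoL : ∀ᶠ M : ℕ in atTop, θ M t ≤ θ M (a₀ * (N' : ℝ) ^ 2) := hmono _ _ htu hleL
  have hclockL := hN₀ N' hN₀N'
  -- ### combine
  filter_upwards [hmonoU, hclockU, hmonoL, hclockL] with M hmU hcU hmL hcL
  constructor
  · calc c' * Real.sqrt a₀ / 2 / Real.sqrt t = c' / (2 * x₀) := by
          rw [hx₀def]; field_simp
      _ ≤ c' / (N' : ℝ) := div_le_div_of_nonneg_left hc'.le hN'pos hN'le
      _ ≤ 1 - θ M (a₀ * (N' : ℝ) ^ 2) := hcL.1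
      _ ≤ 1 - θ M t := by linarith
  · calc 1 - θ M t ≤ 1 - θ M (a₁ * (N : ℝ) ^ 2) := by linarith
      _ ≤ C' / (N : ℝ) := hcU.2
      _ ≤ max C' 0 / (N : ℝ) := div_le_div_of_nonneg_right (le_max_left _ _) hNpos.le
      _ ≤ max C' 0 / (x₁ / 2) := div_le_div_of_nonneg_left (le_max_right _ _) (by positivity) hNhalf
      _ = 2 * max C' 0 * Real.sqrt a₁ / Real.sqrt t := by
          rw [hx₁def]; field_simp

/-- The two-sided tail law at `t = aN²` is the clock law with rate `1/N` (`√(aN²) = √a·N`). [folklore] -/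
theorem clock_of_tail {c C t₀ : ℝ}
    (htail : ∀ t : ℝ, t₀ ≤ t → ∀ᶠ M : ℕ in atTop,
      c / Real.sqrt t ≤ 1 - θ M t ∧ 1 - θ M t ≤ C / Real.sqrt t) :
    ∀ᶠ N : ℕ in atTop, ∀ᶠ M : ℕ in atTop,
      c / (N : ℝ) ≤ 1 - θ M (1 * (N : ℝ) ^ 2) ∧ 1 - θ M (1 * (N : ℝ) ^ 2) ≤ C / (N : ℝ) := by
  have hNev : ∀ᶠ N : ℕ in atTop, t₀ ≤ 1 * (N : ℝ) ^ 2 := by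
    have : Tendsto (fun N : ℕ => 1 * (N : ℝ) ^ 2) atTop atTop := by
      apply Tendsto.const_mul_atTop one_pos
      exact (tendsto_pow_atTop two_ne_zero).comp tendsto_natCast_atTop_atTop
    exact this.eventually_ge_atTop t₀
  filter_upwards [hNev, eventually_ge_atTop 1] with N hN hN1
  have hNr : (0 : ℝ) ≤ N := by positivity
  have hsq : Real.sqrt (1 * (N : ℝ) ^ 2) = N := by rw [one_mul, Real.sqrt_sq hNr]
  filter_upwards [htail _ hN] with M hM
  rw [hsq] at hM
  exact hM

/-- The two-sided tail law implies the sum rule `|1 − θ_M(t)| ≤ ε` for `t ≥ t₁(ε)`, eventually in `M`. [folklore] -/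
theorem sumRule_of_tail {c C t₀ : ℝ} (hc : 0 < c)
    (htail : ∀ t : ℝ, t₀ ≤ t → ∀ᶠ M : ℕ in atTop,
      c / Real.sqrt t ≤ 1 - θ M t ∧ 1 - θ M t ≤ C / Real.sqrt t) :
    ∀ ε : ℝ, 0 < ε → ∃ t₁ : ℝ, ∀ t : ℝ, t₁ ≤ t → ∀ᶠ M : ℕ in atTop, |1 - θ M t| ≤ ε := by
  intro ε hε
  refine ⟨max t₀ (max 1 ((max C 0 / ε) ^ 2)), fun t ht => ?_⟩
  have ht₀ : t₀ ≤ t := le_trans (le_max_left _ _) ht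
  have ht1 : 1 ≤ t := le_trans (le_trans (le_max_left _ _) (le_max_right _ _)) ht
  have htC : (max C 0 / ε) ^ 2 ≤ t := le_trans (le_trans (le_max_right _ _) (le_max_right _ _)) ht
  have hst : 0 < Real.sqrt t := Real.sqrt_pos.2 (by linarith)
  have hC0 : 0 ≤ max C 0 := le_max_right _ _
  have hsC : max C 0 / ε ≤ Real.sqrt t := by
    calc max C 0 / ε = Real.sqrt ((max C 0 / ε) ^ 2) := (Real.sqrt_sq (by positivity)).symm
      _ ≤ Real.sqrt t := Real.sqrt_le_sqrt htC
  filter_upwards [htail t ht₀] with M hM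
  have hlo : 0 ≤ 1 - θ M t := le_trans (div_nonneg hc.le (Real.sqrt_nonneg _)) hM.1
  have hhi : 1 - θ M t ≤ ε := by
    calc 1 - θ M t ≤ C / Real.sqrt t := hM.2
      _ ≤ max C 0 / Real.sqrt t := div_le_div_of_nonneg_right (le_max_left _ _) hst.le
      _ ≤ ε := by
          rw [div_le_iff₀ hst]
          have := mul_le_mul_of_nonneg_left hsC hε.le
          rwa [mul_div_cancel₀ _ hε.ne'] at this
  exact abs_le.2 ⟨by linarith, hhi⟩

/-- `EReal` squeeze: a real sequence eventually bracketed in `[L, U]` with `L > 0` that has a limit in `EReal` converges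
in `ℝ` to a positive real (step 2 of the route's mesh lemma, isolated). [folklore] -/
theorem exists_pos_tendsto_of_bracket_ereal (e : ℕ → ℝ) {L U : ℝ} (hL : 0 < L)
    (hb : ∀ᶠ N : ℕ in atTop, L ≤ e N ∧ e N ≤ U)
    (hNO : ∃ ℓ : EReal, Tendsto (fun N : ℕ => ((e N : ℝ) : EReal)) atTop (𝓝 ℓ)) :
    ∃ κb : ℝ, 0 < κb ∧ Tendsto e atTop (𝓝 κb) := by
  obtain ⟨ℓ, hℓ⟩ := hNO
  have hℓ_ge : ((L : ℝ) : EReal) ≤ ℓ :=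
    ge_of_tendsto hℓ (hb.mono fun N h => EReal.coe_le_coe_iff.2 h.1)
  have hℓ_le : ℓ ≤ ((U : ℝ) : EReal) :=
    le_of_tendsto hℓ (hb.mono fun N h => EReal.coe_le_coe_iff.2 h.2)
  have hℓ_top : ℓ ≠ ⊤ := ne_top_of_le_ne_top (EReal.coe_ne_top _) hℓ_le
  have hℓ_bot : ℓ ≠ ⊥ := ne_bot_of_le_ne_bot (EReal.coe_ne_bot _) hℓ_ge
  refine ⟨ℓ.toReal, ?_, ?_⟩
  · rw [← EReal.coe_toReal hℓ_top hℓ_bot, EReal.coe_le_coe_iff] at hℓ_ge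
    exact lt_of_lt_of_le hL hℓ_ge
  · rw [← EReal.coe_toReal hℓ_top hℓ_bot] at hℓ
    exact EReal.tendsto_coe.1 hℓ

/-- From the `1/N`-bracket of `E_N` to the bracket of `e_N = (N−1)γE_N`: `γc_E/2 ≤ e_N ≤ γ·max C_E 0` for `N ≥ 2`.
[folklore] -/
theorem eventually_bracket_of_escape_bounds {γ cE CE : ℝ} (hγ : 0 < γ) (hcE : 0 < cE)
    (hE : ∀ᶠ N : ℕ in atTop, cE / (N : ℝ) ≤ E N ∧ E N ≤ CE / (N : ℝ)) :
    ∀ᶠ N : ℕ in atTop, γ * cE / 2 ≤ ((N : ℝ) - 1) * γ * E N ∧ ((N : ℝ) - 1) * γ * E N ≤ γ * max CE 0 := by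
  have h2 : ∀ᶠ N : ℕ in atTop, (2 : ℝ) ≤ N := by
    filter_upwards [eventually_ge_atTop 2] with N hN
    exact_mod_cast hN
  filter_upwards [hE, h2] with N hEN hN2
  have hNpos : (0 : ℝ) < N := by linarith
  have hlo : cE ≤ E N * N := (div_le_iff₀ hNpos).1 hEN.1
  have hhi : E N * N ≤ max CE 0 :=
    ((le_div_iff₀ hNpos).1 (hEN.2.trans (div_le_div_of_nonneg_right (le_max_left _ _) hNpos.le)))
  have hEpos : 0 < E N := lt_of_lt_of_le (div_pos hcE hNpos) hEN.1
  have hγE : 0 < γ * E N := mul_pos hγ hEpos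
  constructor
  · nlinarith
  · nlinarith [le_max_right CE 0]

/-- **Tail + crossover ⟹ the `1/N`-bracket of `E_N`** (step 1 of the route's mesh lemma in `E`-currency): at
`t = a₁N², a₀N²` pick one common `M`; `c₂c/(√a₁ N) ≤ E_N ≤ max C₂ 0 · C/(√a₀ N)`. [folklore] -/
theorem escape_bounds_of_tail_crossover {c C t₀ a₀ a₁ c₂ C₂ : ℝ} (hc : 0 < c) (ha₀ : 0 < a₀) (ha₁ : 0 < a₁)
    (hc₂ : 0 < c₂)
    (htail : ∀ t : ℝ, t₀ ≤ t → ∀ᶠ M : ℕ in atTop,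
      c / Real.sqrt t ≤ 1 - θ M t ∧ 1 - θ M t ≤ C / Real.sqrt t)
    (hcross : ∀ᶠ N : ℕ in atTop, ∀ᶠ M : ℕ in atTop,
      c₂ * (1 - θ M (a₁ * (N : ℝ) ^ 2)) ≤ E N ∧ E N ≤ C₂ * (1 - θ M (a₀ * (N : ℝ) ^ 2))) :
    ∀ᶠ N : ℕ in atTop, c₂ * c / Real.sqrt a₁ / (N : ℝ) ≤ E N ∧ E N ≤ max C₂ 0 * C / Real.sqrt a₀ / (N : ℝ) := by
  have hsa₁ : 0 < Real.sqrt a₁ := Real.sqrt_pos.2 ha₁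
  have hsa₀ : 0 < Real.sqrt a₀ := Real.sqrt_pos.2 ha₀
  have hsq : Tendsto (fun N : ℕ => (N : ℝ) ^ 2) atTop atTop :=
    (tendsto_pow_atTop two_ne_zero).comp tendsto_natCast_atTop_atTop
  have ht1 : ∀ᶠ N : ℕ in atTop, t₀ ≤ a₁ * (N : ℝ) ^ 2 :=
    (Tendsto.const_mul_atTop ha₁ hsq).eventually_ge_atTop t₀
  have ht0 : ∀ᶠ N : ℕ in atTop, t₀ ≤ a₀ * (N : ℝ) ^ 2 :=
    (Tendsto.const_mul_atTop ha₀ hsq).eventually_ge_atTop t₀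
  have hN1 : ∀ᶠ N : ℕ in atTop, (1 : ℝ) ≤ N := by
    filter_upwards [eventually_ge_atTop 1] with N hN
    exact_mod_cast hN
  filter_upwards [hN1, ht1, ht0, hcross] with N hN h1 h0 hX
  have hNpos : (0 : ℝ) < N := by linarith
  obtain ⟨M, hM1, hM0, hMX⟩ := ((htail _ h1).and ((htail _ h0).and hX)).exists
  have hsq1 : Real.sqrt (a₁ * (N : ℝ) ^ 2) = Real.sqrt a₁ * N := by
    rw [Real.sqrt_mul ha₁.le, Real.sqrt_sq hNpos.le]
  have hsq0 : Real.sqrt (a₀ * (N : ℝ) ^ 2) = Real.sqrt a₀ * N := by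
    rw [Real.sqrt_mul ha₀.le, Real.sqrt_sq hNpos.le]
  rw [hsq1] at hM1
  rw [hsq0] at hM0
  have hy : 0 ≤ 1 - θ M (a₀ * (N : ℝ) ^ 2) := le_trans (by positivity) hM0.1
  constructor
  · calc c₂ * c / Real.sqrt a₁ / (N : ℝ) = c₂ * (c / (Real.sqrt a₁ * N)) := by field_simp
      _ ≤ c₂ * (1 - θ M (a₁ * (N : ℝ) ^ 2)) := mul_le_mul_of_nonneg_left hM1.1 hc₂.le
      _ ≤ E N := hMX.1
  · calc E N ≤ C₂ * (1 - θ M (a₀ * (N : ℝ) ^ 2)) := hMX.2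
      _ ≤ max C₂ 0 * (1 - θ M (a₀ * (N : ℝ) ^ 2)) := mul_le_mul_of_nonneg_right (le_max_left _ _) hy
      _ ≤ max C₂ 0 * (C / (Real.sqrt a₀ * N)) := mul_le_mul_of_nonneg_left hM0.2 (le_max_right _ _)
      _ = max C₂ 0 * C / Real.sqrt a₀ / (N : ℝ) := by field_simp

end Abstract

/-! ## The target `EscapeLaw` (12234) IS the sub-problem statement -/

/-- **`EscapeLaw ⟹ FouriersLaw`** — the first layer of the route's `closes`, by itself: clause (i) from existence +
`NessUnique_holds`; clause (ii) with `κ(T) = κ_b(T)`, `D 0 = 0` (`totalCurrent_zero`), `D N = (N−1)γE_N` (`N ≥ 1`,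
limit supplied by the proved `ResponseIdentity`). [folklore] -/
theorem fouriersLaw_of_escapeLaw (hE : EscapeLaw) : _root_.FouriersLaw := by
  intro ω₂ lam β γ hω hl hβ hγ
  have huniq := NessUnique_holds ω₂ lam β γ hω hl hβ hγ
  refine ⟨fun N T_L T_R hL hR => ?_, ?_⟩
  · obtain ⟨μ, hμ⟩ := pinnedChain_exists_isSteadyState hω hl hβ hγ N hL hR
    exact ⟨μ, hμ, fun ν hν => huniq N T_L T_R hL hR ν μ hν hμ⟩
  have hE1 := hE ω₂ lam β γ hω hl hβ hγ
  dsimp only at hE1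
  choose κf hκpos hκlim using hE1
  refine ⟨fun T => if hT : 0 < T then κf T hT else 1, fun T hT => ?_, ?_⟩
  · simp only [dif_pos hT]
    exact hκpos T hT
  intro μ hμ T hT
  have hRI := boundaryEscapeDeficit_responseIdentity_holds ω₂ lam β γ hω hl hβ hγ huniq μ hμ T hT
  dsimp only at hRI
  classical
  let Ee : ℕ → ℝ := fun N => 1 - γ / T ^ 2 * (∫ u in Set.Ioi (0 : ℝ),
        if h : 0 < N then
          ∫ z, ((z.2 ⟨0, h⟩) ^ 2 - T) *
              (∫ y, ((y.2 ⟨0, h⟩) ^ 2 - T) ∂((pinnedChain ω₂ lam β γ).transitionKernel N T T u.toNNReal z))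
            ∂((pinnedChain ω₂ lam β γ).gibbsMeasure N T)
        else 0)
  let D : ℕ → ℝ := fun N => if N = 0 then 0 else ((N : ℝ) - 1) * γ * Ee N
  have hDpos : ∀ N : ℕ, 0 < N → D N = ((N : ℝ) - 1) * γ * Ee N := fun N hN => by
    simp [D, hN.ne']
  refine ⟨D, fun N => ?_, ?_⟩
  · rcases Nat.eq_zero_or_pos N with rfl | hN
    · have hD0 : D 0 = 0 := by simp [D]
      rw [hD0]
      simp only [OscillatorChain.totalCurrent_zero, zero_div]
      exact tendsto_const_nhds
    · rw [hDpos N hN]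
      exact (hRI N hN).2
  · simp only [dif_pos hT]
    refine (hκlim T hT).congr' ?_
    filter_upwards [eventually_gt_atTop 0] with N hN
    exact (hDpos N hN).symm

/-- **`FouriersLaw ⟹ EscapeLaw`**: along the canonical steady-state family (choice on the existence theorem) Fourier's
law gives `D_N → κ(T) > 0`, and the proved `ResponseIdentity` with uniqueness of `δ`-limits along `𝓝[≠] 0` identifies
`D_N = (N−1)γE_N` for `N ≥ 1`. [folklore] -/
theorem escapeLaw_of_fouriersLaw (hF : _root_.FouriersLaw) : EscapeLaw := by
  intro ω₂ lam β γ hω hl hβ hγ T hT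
  dsimp only
  obtain ⟨-, κ, hκpos, hκ⟩ := hF ω₂ lam β γ hω hl hβ hγ
  classical
  let μ : (N : ℕ) → ℝ → ℝ → Measure (PhaseSpace N) := fun N T_L T_R =>
    if h : 0 < T_L ∧ 0 < T_R then
      Classical.choose (pinnedChain_exists_isSteadyState hω hl hβ hγ N h.1 h.2) else 0
  have hμ : ∀ (N : ℕ) (T_L T_R : ℝ), 0 < T_L → 0 < T_R →
      (pinnedChain ω₂ lam β γ).IsSteadyState N T_L T_R (μ N T_L T_R) := by
    intro N T_L T_R hL hR
    simp only [μ, dif_pos (And.intro hL hR)]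
    exact Classical.choose_spec (pinnedChain_exists_isSteadyState hω hl hβ hγ N hL hR)
  obtain ⟨D, hD, hDlim⟩ := hκ μ hμ T hT
  have huniq := NessUnique_holds ω₂ lam β γ hω hl hβ hγ
  have hRI := boundaryEscapeDeficit_responseIdentity_holds ω₂ lam β γ hω hl hβ hγ huniq μ hμ T hT
  dsimp only at hRI
  refine ⟨κ T, hκpos T hT, ?_⟩
  refine hDlim.congr' ?_
  filter_upwards [eventually_gt_atTop 0] with N hN
  exact tendsto_nhds_unique (hD N) (hRI N hN).2

/-- **The route's target is the sub-problem statement**: `FouriersLaw ↔ EscapeLaw` (12234), unconditionally. [folklore] -/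
theorem fouriersLaw_iff_escapeLaw : _root_.FouriersLaw ↔ EscapeLaw :=
  ⟨escapeLaw_of_fouriersLaw, fouriersLaw_of_escapeLaw⟩

/-! ## The pair (12235, 12236) meets the bounded-response barrier head-on -/

/-- `HalfChainTailLaw ∧ DiffusiveCrossover ⟹ BondHeatUncertainty.BoundedResponse` (item 11071 of the sibling route) —
one application of the landed `stub_ohmicFloor_of_tail_crossover` and `boundedResponse_of_ohmicFloor`. [folklore] -/
theorem boundedResponse_of_halfChainTailLaw_diffusiveCrossover (hT : HalfChainTailLaw) (hX : DiffusiveCrossover) :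
    Summit.AtomisticToContinuum.FouriersLaw.Theses.BondHeatUncertainty.BoundedResponse :=
  boundedResponse_of_ohmicFloor (stub_ohmicFloor_of_tail_crossover hT hX)

/-- … i.e. the catalogued barrier target `HasBoundedResponse (pinnedChain ω₂ lam β γ)` of
`Literature/Barriers/AtomisticToContinuum/FixedLengthNoConductivityControl.lean` at every parameter point. [folklore] -/
theorem hasBoundedResponse_of_halfChainTailLaw_diffusiveCrossover (hT : HalfChainTailLaw) (hX : DiffusiveCrossover)
    {ω₂ lam β γ : ℝ} (hω : 0 < ω₂) (hl : 0 < lam) (hβ : 0 < β) (hγ : 0 < γ) :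
    Literature.Barriers.AtomisticToContinuum.HasBoundedResponse (pinnedChain ω₂ lam β γ) :=
  boundedResponse_of_halfChainTailLaw_diffusiveCrossover hT hX ω₂ lam β γ hω hl hβ hγ

/-! ## The Ohmic bracket `E_N ≍ 1/N` — the only thing `closes` takes from the pair (12235, 12236) -/

/-- **The OHMIC BRACKET** (`E`-currency): `∃ c_E > 0, C_E` with `c_E/N ≤ E_N ≤ C_E/N` for all large `N` — bounded
response (`E_N ≤ C_E/N` ⟺ item 11071, `boundedResponse_iff_ohmicFloor`) AND no insulation (`E_N ≥ c_E/N`, the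
conductance floor of item 11749 in `E`-currency).  `closes` consumes `HalfChainTailLaw ∧ DiffusiveCrossover` only through
this bracket (`ohmicBracket_of_halfChainTailLaw_diffusiveCrossover`, then `escapeLaw_of_ohmicBracket_escapeNonOscillation`). -/
def OhmicBracket : Prop :=
  ∀ ω₂ lam β γ : ℝ, 0 < ω₂ → 0 < lam → 0 < β → 0 < γ → ∀ T : ℝ, 0 < T → (let P := Literature.MathematicalPhysics.KineticTheory.HeatConduction.pinnedChain ω₂ lam β γ; let K : ℕ → ℝ → ℝ := fun N u => if h : 0 < N then ∫ z, ((z.2 ⟨0, h⟩) ^ 2 - T) * (∫ y, ((y.2 ⟨0, h⟩) ^ 2 - T) ∂(P.transitionKernel N T T u.toNNReal z)) ∂(P.gibbsMeasure N T) else 0; let E : ℕ → ℝ := fun N => 1 - γ / T ^ 2 * ∫ u in Set.Ioi (0 : ℝ), K N u; ∃ cE CE : ℝ, 0 < cE ∧ ∀ᶠ N : ℕ in Filter.atTop, cE / (N : ℝ) ≤ E N ∧ E N ≤ CE / (N : ℝ))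

/-- `HalfChainTailLaw ∧ DiffusiveCrossover ⟹ OhmicBracket`. [folklore] -/
theorem ohmicBracket_of_halfChainTailLaw_diffusiveCrossover (hT : HalfChainTailLaw) (hX : DiffusiveCrossover) :
    OhmicBracket := by
  intro ω₂ lam β γ hω hl hβ hγ T hT' P K E
  let θ : ℕ → ℝ → ℝ := fun N t => γ / T ^ 2 * ∫ u in (0 : ℝ)..t, K N u
  obtain ⟨c, C, t₀, hc, -, htail⟩ : ∃ c C t₀ : ℝ, 0 < c ∧ 0 < t₀ ∧ ∀ t : ℝ, t₀ ≤ t →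
      ∀ᶠ M : ℕ in atTop, c / Real.sqrt t ≤ 1 - θ M t ∧ 1 - θ M t ≤ C / Real.sqrt t :=
    hT ω₂ lam β γ hω hl hβ hγ T hT'
  obtain ⟨a₀, a₁, c₂, C₂, ha₀, ha₁, hc₂, hcross⟩ : ∃ a₀ a₁ c₂ C₂ : ℝ, 0 < a₀ ∧ 0 < a₁ ∧ 0 < c₂ ∧
      ∀ᶠ N : ℕ in atTop, ∀ᶠ M : ℕ in atTop,
        c₂ * (1 - θ M (a₁ * (N : ℝ) ^ 2)) ≤ E N ∧ E N ≤ C₂ * (1 - θ M (a₀ * (N : ℝ) ^ 2)) :=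
    hX ω₂ lam β γ hω hl hβ hγ T hT'
  exact ⟨_, _, by positivity, escape_bounds_of_tail_crossover θ E hc ha₀ ha₁ hc₂ htail hcross⟩

/-- `EscapeLaw ⟹ OhmicBracket` (a convergent `(N−1)γE_N → κ_b > 0` is eventually bracketed). [folklore] -/
theorem ohmicBracket_of_escapeLaw (hE : EscapeLaw) : OhmicBracket := by
  intro ω₂ lam β γ hω hl hβ hγ T hT' P K E
  obtain ⟨κb, hκb, hlim⟩ : ∃ κb : ℝ, 0 < κb ∧
      Tendsto (fun N : ℕ => ((N : ℝ) - 1) * γ * E N) atTop (𝓝 κb) :=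
    hE ω₂ lam β γ hω hl hβ hγ T hT'
  exact ⟨_, _, by positivity, eventually_escape_bounds E hγ hκb hlim⟩

/-- `OhmicBracket ∧ EscapeNonOscillation ⟹ EscapeLaw` (`EReal` squeeze). [folklore] -/
theorem escapeLaw_of_ohmicBracket_escapeNonOscillation (hB : OhmicBracket) (hNO : EscapeNonOscillation) :
    EscapeLaw := by
  intro ω₂ lam β γ hω hl hβ hγ T hT' P K E
  obtain ⟨cE, CE, hcE, hEb⟩ : ∃ cE CE : ℝ, 0 < cE ∧ ∀ᶠ N : ℕ in atTop, cE / (N : ℝ) ≤ E N ∧ E N ≤ CE / (N : ℝ) :=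
    hB ω₂ lam β γ hω hl hβ hγ T hT'
  have hNO' : ∃ ℓ : EReal, Tendsto (fun N : ℕ => ((((N : ℝ) - 1) * γ * E N : ℝ) : EReal)) atTop (𝓝 ℓ) :=
    hNO ω₂ lam β γ hω hl hβ hγ T hT'
  exact exists_pos_tendsto_of_bracket_ereal (fun N : ℕ => ((N : ℝ) - 1) * γ * E N) (by positivity)
    (eventually_bracket_of_escape_bounds E hγ hcE hEb) hNO'

/-- The Ohmic bracket implies the sibling route's output `BoundedResponse` (item 11071). [folklore] -/
theorem boundedResponse_of_ohmicBracket (hB : OhmicBracket) :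
    Summit.AtomisticToContinuum.FouriersLaw.Theses.BondHeatUncertainty.BoundedResponse := by
  refine boundedResponse_of_ohmicFloor fun ω₂ lam β γ hω hl hβ hγ T hT' => ?_
  have h := hB ω₂ lam β γ hω hl hβ hγ T hT'
  dsimp only at h
  obtain ⟨cE, CE, -, hEb⟩ := h
  obtain ⟨N₀, hN₀⟩ := eventually_atTop.1 hEb
  exact ⟨CE, N₀, fun N hN => (hN₀ N hN).2⟩

/-- `FouriersLaw ↔ OhmicBracket ∧ EscapeNonOscillation`: the sub-problem statement is the Ohmic bracket plus existence of
the limit. [folklore] -/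
theorem fouriersLaw_iff_ohmicBracket_escapeNonOscillation :
    _root_.FouriersLaw ↔ (OhmicBracket ∧ EscapeNonOscillation) := by
  constructor
  · intro hF
    have hE := escapeLaw_of_fouriersLaw hF
    refine ⟨ohmicBracket_of_escapeLaw hE, ?_⟩
    intro ω₂ lam β γ hω hl hβ hγ T hT' P K E
    obtain ⟨κb, -, hlim⟩ : ∃ κb : ℝ, 0 < κb ∧
        Tendsto (fun N : ℕ => ((N : ℝ) - 1) * γ * E N) atTop (𝓝 κb) :=
      hE ω₂ lam β γ hω hl hβ hγ T hT'
    exact ⟨(κb : EReal), EReal.tendsto_coe.2 hlim⟩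
  · rintro ⟨hB, hNO⟩
    exact fouriersLaw_of_escapeLaw (escapeLaw_of_ohmicBracket_escapeNonOscillation hB hNO)

/-! ## Placing the crux: the clock law, the sum rule, and the on-path theorem -/

/-- **Eventual monotonicity of the boundary curve** (regularity hypothesis; VERBATIM the s2 decl
`StrategistS2Laplace.EventualMonotone`): there is `u₀ > 0` such that for `u₀ ≤ a ≤ b`, eventually in `M`,
`θ_M(a) ≤ θ_M(b)` — i.e. the boundary kinetic-energy autocorrelation `K_M` is eventually nonnegative, eventually in `M`.
True at the harmonic corner (`K ≥ 0` there); open in general; testable by MD. -/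
def EventualMonotone : Prop :=
  ∀ ω₂ lam β γ : ℝ, 0 < ω₂ → 0 < lam → 0 < β → 0 < γ → ∀ T : ℝ, 0 < T → (let P := Literature.MathematicalPhysics.KineticTheory.HeatConduction.pinnedChain ω₂ lam β γ; let K : ℕ → ℝ → ℝ := fun N u => if h : 0 < N then ∫ z, ((z.2 ⟨0, h⟩) ^ 2 - T) * (∫ y, ((y.2 ⟨0, h⟩) ^ 2 - T) ∂(P.transitionKernel N T T u.toNNReal z)) ∂(P.gibbsMeasure N T) else 0; let θ : ℕ → ℝ → ℝ := fun N t => γ / T ^ 2 * ∫ u in (0 : ℝ)..t, K N u; ∃ u₀ : ℝ, 0 < u₀ ∧ ∀ a b : ℝ, u₀ ≤ a → a ≤ b → ∀ᶠ M : ℕ in Filter.atTop, θ M a ≤ θ M b)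

/-- **The CLOCK TAIL LAW** — the crux sampled at the diffusive clock only: `∃ a₀ a₁ c > 0, C` with, for all large `N`,
eventually in `M`, `c/N ≤ 1 − θ_M(a₀N²)` and `1 − θ_M(a₁N²) ≤ C/N`.  Implied by the crux (`clockTailLaw_of_halfChainTailLaw`);
gives it back under `EventualMonotone`; and is implied by `FouriersLaw ∧ DiffusiveCrossover ∧ SumRule ∧ EventualMonotone`. -/
def ClockTailLaw : Prop :=
  ∀ ω₂ lam β γ : ℝ, 0 < ω₂ → 0 < lam → 0 < β → 0 < γ → ∀ T : ℝ, 0 < T → (let P := Literature.MathematicalPhysics.KineticTheory.HeatConduction.pinnedChain ω₂ lam β γ; let K : ℕ → ℝ → ℝ := fun N u => if h : 0 < N then ∫ z, ((z.2 ⟨0, h⟩) ^ 2 - T) * (∫ y, ((y.2 ⟨0, h⟩) ^ 2 - T) ∂(P.transitionKernel N T T u.toNNReal z)) ∂(P.gibbsMeasure N T) else 0; let θ : ℕ → ℝ → ℝ := fun N t => γ / T ^ 2 * ∫ u in (0 : ℝ)..t, K N u; ∃ a₀ a₁ c C : ℝ, 0 < a₀ ∧ 0 < a₁ ∧ 0 <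 c ∧ ∀ᶠ N : ℕ in Filter.atTop, ∀ᶠ M : ℕ in Filter.atTop, c / (N : ℝ) ≤ 1 - θ M (a₀ * (N : ℝ) ^ 2) ∧ 1 - θ M (a₁ * (N : ℝ) ^ 2) ≤ C / (N : ℝ))

/-- The crux implies the clock law (sample at `t = N²`). [folklore] -/
theorem clockTailLaw_of_halfChainTailLaw (hT : HalfChainTailLaw) : ClockTailLaw := by
  intro ω₂ lam β γ hω hl hβ hγ T hT' P K θ
  obtain ⟨c, C, t₀, hc, -, htail⟩ : ∃ c C t₀ : ℝ, 0 < c ∧ 0 < t₀ ∧ ∀ t : ℝ, t₀ ≤ t →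
      ∀ᶠ M : ℕ in atTop, c / Real.sqrt t ≤ 1 - θ M t ∧ 1 - θ M t ≤ C / Real.sqrt t :=
    hT ω₂ lam β γ hω hl hβ hγ T hT'
  exact ⟨1, 1, c, C, one_pos, one_pos, hc, clock_of_tail θ htail⟩

/-- The crux implies the sum rule (item 12241). [folklore] -/
theorem sumRule_of_halfChainTailLaw (hT : HalfChainTailLaw) : SumRule := by
  intro ω₂ lam β γ hω hl hβ hγ T hT' P K θ
  obtain ⟨c, C, t₀, hc, -, htail⟩ : ∃ c C t₀ : ℝ, 0 < c ∧ 0 < t₀ ∧ ∀ t : ℝ, t₀ ≤ t →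
      ∀ᶠ M : ℕ in atTop, c / Real.sqrt t ≤ 1 - θ M t ∧ 1 - θ M t ≤ C / Real.sqrt t :=
    hT ω₂ lam β γ hω hl hβ hγ T hT'
  exact sumRule_of_tail θ hc htail

/-- **Clock law + eventual monotonicity ⟹ the crux.** [folklore] -/
theorem halfChainTailLaw_of_clockTailLaw (hMono : EventualMonotone) (hCl : ClockTailLaw) : HalfChainTailLaw := by
  intro ω₂ lam β γ hω hl hβ hγ T hT' P K θ
  obtain ⟨u₀, hu₀, hmono⟩ : ∃ u₀ : ℝ, 0 < u₀ ∧ ∀ a b : ℝ, u₀ ≤ a → a ≤ b →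
      ∀ᶠ M : ℕ in atTop, θ M a ≤ θ M b :=
    hMono ω₂ lam β γ hω hl hβ hγ T hT'
  obtain ⟨a₀, a₁, c', C', ha₀, ha₁, hc', hclock⟩ : ∃ a₀ a₁ c C : ℝ, 0 < a₀ ∧ 0 < a₁ ∧ 0 < c ∧
      ∀ᶠ N : ℕ in atTop, ∀ᶠ M : ℕ in atTop,
        c / (N : ℝ) ≤ 1 - θ M (a₀ * (N : ℝ) ^ 2) ∧ 1 - θ M (a₁ * (N : ℝ) ^ 2) ≤ C / (N : ℝ) :=
    hCl ω₂ lam β γ hω hl hβ hγ T hT'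
  exact tail_of_clock_monotone θ ha₀ ha₁ hc' hu₀ hmono hclock

/-- **`OhmicBracket ∧ DiffusiveCrossover ∧ SumRule ∧ EventualMonotone ⟹ ClockTailLaw`**: the `1/N`-bracket of `E_N`
transported to the clock by the crossover; `C₂ > 0` forced by `crossoverConst_pos`. [folklore] -/
theorem clockTailLaw_of_ohmicBracket (hMono : EventualMonotone) (hS : SumRule) (hX : DiffusiveCrossover)
    (hB : OhmicBracket) : ClockTailLaw := by
  intro ω₂ lam β γ hω hl hβ hγ T hT' P K θ
  let E : ℕ → ℝ := fun N => 1 - γ / T ^ 2 * ∫ u in Set.Ioi (0 : ℝ), K N u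
  obtain ⟨u₀, hu₀, hmono⟩ : ∃ u₀ : ℝ, 0 < u₀ ∧ ∀ a b : ℝ, u₀ ≤ a → a ≤ b →
      ∀ᶠ M : ℕ in atTop, θ M a ≤ θ M b :=
    hMono ω₂ lam β γ hω hl hβ hγ T hT'
  have hsum : ∀ ε : ℝ, 0 < ε → ∃ t₀ : ℝ, ∀ t : ℝ, t₀ ≤ t → ∀ᶠ M : ℕ in atTop, |1 - θ M t| ≤ ε :=
    hS ω₂ lam β γ hω hl hβ hγ T hT'
  obtain ⟨a₀, a₁, c₂, C₂, ha₀, ha₁, hc₂, hcross⟩ : ∃ a₀ a₁ c₂ C₂ : ℝ, 0 < a₀ ∧ 0 < a₁ ∧ 0 < c₂ ∧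
      ∀ᶠ N : ℕ in atTop, ∀ᶠ M : ℕ in atTop,
        c₂ * (1 - θ M (a₁ * (N : ℝ) ^ 2)) ≤ E N ∧ E N ≤ C₂ * (1 - θ M (a₀ * (N : ℝ) ^ 2)) :=
    hX ω₂ lam β γ hω hl hβ hγ T hT'
  obtain ⟨cE, CE, hcE, hEb⟩ : ∃ cE CE : ℝ, 0 < cE ∧ ∀ᶠ N : ℕ in atTop, cE / (N : ℝ) ≤ E N ∧ E N ≤ CE / (N : ℝ) :=
    hB ω₂ lam β γ hω hl hβ hγ T hT'
  have hC₂ : 0 < C₂ := crossoverConst_pos θ E ha₀ hcE hmono hsum hEb hcross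
  refine ⟨a₀, a₁, cE / C₂, CE / c₂, ha₀, ha₁, by positivity, ?_⟩
  filter_upwards [clock_upper θ E hc₂ hEb hcross, clock_lower θ E hC₂ hEb hcross] with N hu hl'
  filter_upwards [hu, hl'] with M h1 h2
  exact ⟨h2, h1⟩

/-- `EscapeLaw ∧ DiffusiveCrossover ∧ SumRule ∧ EventualMonotone ⟹ ClockTailLaw`. [folklore] -/
theorem clockTailLaw_of_escapeLaw (hMono : EventualMonotone) (hS : SumRule) (hX : DiffusiveCrossover)
    (hE : EscapeLaw) : ClockTailLaw :=
  clockTailLaw_of_ohmicBracket hMono hS hX (ohmicBracket_of_escapeLaw hE)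

/-- **`HalfChainTailLaw ↔ OhmicBracket ∧ SumRule` modulo `DiffusiveCrossover` (12236) and `EventualMonotone`** — the
sharpest placing: given the route's own second crux and the monotone regularity, the crux IS "bounded response + Ohmic
floor at the contact" (the `FixedLengthNoConductivityControl` barrier content, BLR 2000 §6.3) plus the sum rule; no
`EscapeNonOscillation`, no steady states, no `δ`-limit involved. [folklore] -/
theorem halfChainTailLaw_iff_ohmicBracket (hMono : EventualMonotone) (hX : DiffusiveCrossover) :
    HalfChainTailLaw ↔ (OhmicBracket ∧ SumRule) :=
  ⟨fun hT => ⟨ohmicBracket_of_halfChainTailLaw_diffusiveCrossover hT hX, sumRule_of_halfChainTailLaw hT⟩,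
    fun h => halfChainTailLaw_of_clockTailLaw hMono (clockTailLaw_of_ohmicBracket hMono h.2 hX h.1)⟩

/-- **THE ON-PATH THEOREM (target form).**  `EventualMonotone → SumRule → DiffusiveCrossover → EscapeLaw →
HalfChainTailLaw`. [folklore] -/
theorem halfChainTailLaw_of_escapeLaw (hMono : EventualMonotone) (hS : SumRule) (hX : DiffusiveCrossover)
    (hE : EscapeLaw) : HalfChainTailLaw :=
  halfChainTailLaw_of_clockTailLaw hMono (clockTailLaw_of_escapeLaw hMono hS hX hE)

/-- **THE ON-PATH THEOREM.**  Modulo the route's own crux `DiffusiveCrossover` (12236), its own support item `SumRule`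
(12241, necessary for the crux) and the regularity `EventualMonotone`, the crux `HalfChainTailLaw` (12235) is IMPLIED BY
the sub-problem statement `FouriersLaw`. [folklore] -/
theorem halfChainTailLaw_of_fouriersLaw (hMono : EventualMonotone) (hS : SumRule) (hX : DiffusiveCrossover)
    (hF : _root_.FouriersLaw) : HalfChainTailLaw :=
  halfChainTailLaw_of_escapeLaw hMono hS hX (escapeLaw_of_fouriersLaw hF)

/-- The route's deciding theorem with its two proved items discharged:
`HalfChainTailLaw → DiffusiveCrossover → EscapeNonOscillation → FouriersLaw`. [folklore] -/
theorem fouriersLaw_of_halfChainTailLaw (hT : HalfChainTailLaw) (hX : DiffusiveCrossover)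
    (hNO : EscapeNonOscillation) : _root_.FouriersLaw :=
  closes NessUnique_holds boundaryEscapeDeficit_responseIdentity_holds hT hX hNO

/-- **PLACING THEOREM.**  Given the route's other open cruxes `DiffusiveCrossover` (12236) and `EscapeNonOscillation`
(12238) and the regularity `EventualMonotone`, the crux `HalfChainTailLaw` (12235) is EXACTLY
`FouriersLaw ∧ SumRule` — the sub-problem statement plus the route's cheapest-kill milestone (12241). [folklore] -/
theorem halfChainTailLaw_iff (hMono : EventualMonotone) (hX : DiffusiveCrossover) (hNO : EscapeNonOscillation) :
    HalfChainTailLaw ↔ (_root_.FouriersLaw ∧ SumRule) :=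
  ⟨fun hT => ⟨fouriersLaw_of_halfChainTailLaw hT hX hNO, sumRule_of_halfChainTailLaw hT⟩,
    fun h => halfChainTailLaw_of_fouriersLaw hMono h.2 hX h.1⟩

/-- Corollary: modulo the same three hypotheses the crux and the route's target coincide,
`HalfChainTailLaw ↔ EscapeLaw ∧ SumRule`. [folklore] -/
theorem halfChainTailLaw_iff_escapeLaw (hMono : EventualMonotone) (hX : DiffusiveCrossover)
    (hNO : EscapeNonOscillation) : HalfChainTailLaw ↔ (EscapeLaw ∧ SumRule) := by
  rw [halfChainTailLaw_iff hMono hX hNO, fouriersLaw_iff_escapeLaw]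

end Summit.AtomisticToContinuum.FouriersLaw.Cruxes.HalfChainTailLaw.StrategistR1

end
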